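import Mathlib
import Summits.Ventures.PercRepro2.Defs
import Summits.Ventures.PercRepro2.Independence
import Summits.Ventures.PercRepro2.Harris
import Summits.Ventures.PercRepro2.Graph
import Summits.Ventures.PercRepro2.Exploration
import Summits.Ventures.PercRepro2.Events
import Summits.Ventures.PercRepro2.Induced
import Summits.Ventures.PercRepro2.GateDefs
import Summits.Ventures.PercRepro2.VTXDefs

/-!
# The product split between the edges at `z` and the edges of `H = G − z` (blind cell PercRepro2,
typer-1; lead g11 16:30:35Z "make VTX_all ↔ ConW_all formal (the product split between the z-edges
and the H-edges)")

* `pinZ p z`: the weights with every edge at `z` closed (`0` on `touches ends {z}`); admissible.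
  **`prob_pinZ_eq`**: `P_{pinZ p}(A) = P_p(delEvent z A)` — the `H`-law is the pinned law (glue
  decomposition `expect_eq_sum_glue` along `touches ends {z}`: the pinned weight of the `z`-part is
  the indicator of "all closed", and `delConfig` of a glued configuration is the glue with the
  `z`-part closed).
* `nbhd z ω`: the open neighbourhood `N(z)` (a `Finset`, `z` excluded); `nbhdEvent z W = {N(z) = W}`.
  **`prob_delEvent_inter_nbhdEvent`**: `P(delEvent z A ∩ {N(z) = W}) = P(delEvent z A) · P(N(z) = W)`
  (the `H`-events depend on the edges off `z`, `N(z)` on the edges at `z`).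
* **`mem_avoidAll_iff_del_gateEvent`**: for `s ≠ z`, `z ∉ T`,
  `s ↮_G T ↔ delConfig ends {z} ω ∈ Gate.gateEvent s T (N(z)) (N(z))` — the `G`-avoidance is the
  gate of `H` at the random set `W = N(z)` (`NewVertex.conn_iff_del`).
* **`prob_eq_sum_nbhdEvent`**: `P(A) = Σ_W P(A ∩ {N(z) = W})`.
-/

namespace Summit.Ventures.PercRepro2

namespace NewVertex

open scoped Classical

variable {V : Type*} {E : Type*} [Fintype E] [DecidableEq E] [Fintype V] [DecidableEq V]
  {R : Type*} [Field R] [LinearOrder R] [IsStrictOrderedRing R]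

variable (p : E → R) (ends : E → Sym2 V) (z : V)

/-! ## The pinned weights and the pinning identity -/

/-- The weights with every edge at `z` closed. -/
noncomputable def pinZ : E → R := fun e => if e ∈ touches ends {z} then 0 else p e

omit [Fintype E] [DecidableEq E] [LinearOrder R] [IsStrictOrderedRing R] in
/-- `pinZ p` on an edge at `z`. -/
lemma pinZ_of_mem {e : E} (h : e ∈ touches ends {z}) : pinZ p ends z e = 0 := by
  simp [pinZ, h]

omit [Fintype E] [DecidableEq E] [LinearOrder R] [IsStrictOrderedRing R] in
/-- `pinZ p` on an edge not at `z`. -/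
lemma pinZ_of_notMem {e : E} (h : e ∉ touches ends {z}) : pinZ p ends z e = p e := by
  simp [pinZ, h]

omit [Fintype E] [DecidableEq E] in
/-- The pinned weights are admissible. -/
lemma isProbVec_pinZ (hp : IsProbVec p) : IsProbVec (pinZ p ends z) := by
  refine ⟨fun e => ?_, fun e => ?_⟩
  · unfold pinZ; split_ifs
    · exact le_rfl
    · exact hp.nonneg e
  · unfold pinZ; split_ifs
    · exact zero_le_one
    · exact hp.le_one e

omit [Fintype E] [DecidableEq E] in
/-- `delConfig` of a glued configuration closes the `z`-part. -/
lemma delConfig_glue (σ₁ : {e // e ∈ touches ends {z}} → Bool)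
    (σ₂ : {e // e ∉ touches ends {z}} → Bool) :
    delConfig ends {z} (glue (touches ends {z}) σ₁ σ₂) =
      glue (touches ends {z}) (fun _ => false) σ₂ := by
  funext e
  by_cases h : e ∈ touches ends {z}
  · rw [delConfig_apply_of_mem h, glue_apply_of_mem _ _ _ h]
  · rw [delConfig_apply_of_notMem h, glue_apply_of_notMem _ _ _ h, glue_apply_of_notMem _ _ _ h]

omit [DecidableEq E] [LinearOrder R] [IsStrictOrderedRing R] in
/-- The pinned weight of the `z`-part is the indicator of "every edge at `z` closed". -/
lemma weight_pinZ_part (σ₁ : {e // e ∈ touches ends {z}} → Bool) :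
    weight (fun i : {e // e ∈ touches ends {z}} => pinZ p ends z i) σ₁ =
      if σ₁ = fun _ => false then 1 else 0 := by
  unfold weight
  split_ifs with h
  · subst h
    refine Finset.prod_eq_one fun i _ => ?_
    simp only [pinZ_of_mem p ends z i.2]
    simp
  · obtain ⟨i, hi⟩ : ∃ i, σ₁ i = true := by
      by_contra hc
      apply h
      funext i
      cases hσ : σ₁ i with
      | false => rfl
      | true => exact absurd ⟨i, hσ⟩ hc
    refine Finset.prod_eq_zero (Finset.mem_univ i) ?_
    simp only [pinZ_of_mem p ends z i.2, hi]
    simp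

omit [DecidableEq E] [LinearOrder R] [IsStrictOrderedRing R] in
/-- Off `z` the pinned weights are the original ones. -/
lemma weight_pinZ_rest (σ₂ : {e // e ∉ touches ends {z}} → Bool) :
    weight (fun i : {e // e ∉ touches ends {z}} => pinZ p ends z i) σ₂ =
      weight (fun i : {e // e ∉ touches ends {z}} => p i) σ₂ := by
  unfold weight
  refine Finset.prod_congr rfl fun i _ => ?_
  simp only [pinZ_of_notMem p ends z i.2]

omit [LinearOrder R] [IsStrictOrderedRing R] in
/-- **The pinning identity**: `P_{pinZ p}(A) = P_p(delEvent z A)`. -/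
theorem prob_pinZ_eq (A : Set (Config E)) :
    prob (pinZ p ends z) A = prob p (delEvent ends z A) := by
  rw [prob_eq_expect_indicator, prob_eq_expect_indicator,
    expect_eq_sum_glue _ _ (touches ends {z}), expect_eq_sum_glue _ _ (touches ends {z})]
  -- right-hand side: the `z`-part integrates out
  have hR : ∀ σ₂ : {e // e ∉ touches ends {z}} → Bool,
      (∑ σ₁ : {e // e ∈ touches ends {z}} → Bool,
        weight (fun i : {e // e ∈ touches ends {z}} => p i) σ₁ *
          weight (fun i : {e // e ∉ touches ends {z}} => p i) σ₂ *
          (delEvent ends z A).indicator 1 (glue (touches ends {z}) σ₁ σ₂)) =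
      weight (fun i : {e // e ∉ touches ends {z}} => p i) σ₂ *
        A.indicator 1 (glue (touches ends {z}) (fun _ => false) σ₂) := by
    intro σ₂
    have hind : ∀ σ₁ : {e // e ∈ touches ends {z}} → Bool,
        (delEvent ends z A).indicator (1 : Config E → R) (glue (touches ends {z}) σ₁ σ₂) =
          A.indicator 1 (glue (touches ends {z}) (fun _ => false) σ₂) := by
      intro σ₁
      simp only [delEvent, Set.indicator_apply, Set.mem_setOf_eq, delConfig_glue, Pi.one_apply]
    simp_rw [hind]
    rw [← Finset.sum_mul, ← Finset.sum_mul, sum_weight, one_mul]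
  -- left-hand side: only the all-closed `z`-part survives
  have hL : ∀ σ₂ : {e // e ∉ touches ends {z}} → Bool,
      (∑ σ₁ : {e // e ∈ touches ends {z}} → Bool,
        weight (fun i : {e // e ∈ touches ends {z}} => pinZ p ends z i) σ₁ *
          weight (fun i : {e // e ∉ touches ends {z}} => pinZ p ends z i) σ₂ *
          A.indicator 1 (glue (touches ends {z}) σ₁ σ₂)) =
      weight (fun i : {e // e ∉ touches ends {z}} => p i) σ₂ *
        A.indicator 1 (glue (touches ends {z}) (fun _ => false) σ₂) := by
    intro σ₂
    rw [Finset.sum_eq_single (fun _ => false)]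
    · rw [weight_pinZ_part, weight_pinZ_rest, if_pos rfl, one_mul]
    · intro σ₁ _ hne
      rw [weight_pinZ_part, if_neg hne, zero_mul, zero_mul]
    · intro h; exact absurd (Finset.mem_univ _) h
  rw [Finset.sum_comm]
  conv_rhs => rw [Finset.sum_comm]
  refine Finset.sum_congr rfl fun σ₂ _ => ?_
  rw [hL σ₂, hR σ₂]

/-! ## The open neighbourhood of `z` -/

/-- The open neighbourhood `N(z)` of `z` (as a `Finset`, `z` itself excluded). -/
noncomputable def nbhd (ω : Config E) : Finset V :=
  Finset.univ.filter (fun v => OpenAdj ends ω z v ∧ v ≠ z)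

omit [DecidableEq E] in
/-- Membership in `N(z)`. -/
lemma mem_nbhd {ω : Config E} {v : V} : v ∈ nbhd ends z ω ↔ OpenAdj ends ω z v ∧ v ≠ z := by
  simp [nbhd]

/-- The event `{N(z) = W}`. -/
def nbhdEvent (W : Finset V) : Set (Config E) := {ω | nbhd ends z ω = W}

omit [DecidableEq E] in
/-- `N(z)` is determined by the edges at `z`. -/
lemma nbhd_eq_of_eqOn {ω ω' : Config E} (h : ∀ e ∈ touches ends {z}, ω e = ω' e) :
    nbhd ends z ω = nbhd ends z ω' := by
  ext v
  simp only [mem_nbhd]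
  constructor
  · rintro ⟨⟨e, he, hends⟩, hv⟩
    refine ⟨⟨e, ?_, hends⟩, hv⟩
    rw [← h e (mem_touches_of_ends hends (Or.inl (Set.mem_singleton _)))]
    exact he
  · rintro ⟨⟨e, he, hends⟩, hv⟩
    refine ⟨⟨e, ?_, hends⟩, hv⟩
    rw [h e (mem_touches_of_ends hends (Or.inl (Set.mem_singleton _)))]
    exact he

omit [DecidableEq E] in
/-- `{N(z) = W}` depends on the edges at `z`. -/
lemma dependsOn_nbhdEvent (W : Finset V) :
    DependsOn (· ∈ nbhdEvent ends z W) (touches ends {z}) := by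
  intro ω ω' h
  simp only [nbhdEvent, Set.mem_setOf_eq]
  rw [nbhd_eq_of_eqOn ends z h]

omit [Fintype E] [DecidableEq E] in
/-- `delEvent z A` depends on the edges off `z`. -/
lemma dependsOn_delEvent (A : Set (Config E)) :
    DependsOn (· ∈ delEvent ends z A) (touches ends {z})ᶜ := by
  intro ω ω' h
  simp only [delEvent, Set.mem_setOf_eq]
  have : delConfig ends {z} ω = delConfig ends {z} ω' := by
    funext e
    by_cases he : e ∈ touches ends {z}
    · rw [delConfig_apply_of_mem he, delConfig_apply_of_mem he]
    · rw [delConfig_apply_of_notMem he, delConfig_apply_of_notMem he]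
      exact h e he
  rw [this]

omit [LinearOrder R] [IsStrictOrderedRing R] in
/-- **Independence of the `H`-events and `N(z)`**. -/
theorem prob_delEvent_inter_nbhdEvent (A : Set (Config E)) (W : Finset V) :
    prob p (delEvent ends z A ∩ nbhdEvent ends z W) =
      prob p (delEvent ends z A) * prob p (nbhdEvent ends z W) :=
  prob_inter_eq_mul_of_dependsOn p (F₁ := (touches ends {z})ᶜ) (F₂ := touches ends {z})
    disjoint_compl_left (dependsOn_delEvent ends z A) (dependsOn_nbhdEvent ends z W)

omit [LinearOrder R] [IsStrictOrderedRing R] in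
/-- **Partition by `N(z)`**: `P(A) = Σ_W P(A ∩ {N(z) = W})`. -/
theorem prob_eq_sum_nbhdEvent (A : Set (Config E)) :
    prob p A = ∑ W : Finset V, prob p (A ∩ nbhdEvent ends z W) := by
  unfold prob
  rw [Finset.sum_comm]
  refine Finset.sum_congr rfl fun ω _ => ?_
  rw [Finset.sum_eq_single (nbhd ends z ω)]
  · by_cases hA : ω ∈ A
    · rw [Set.indicator_of_mem hA,
        Set.indicator_of_mem (show ω ∈ A ∩ nbhdEvent ends z (nbhd ends z ω) from ⟨hA, rfl⟩)]
    · rw [Set.indicator_of_notMem hA, Set.indicator_of_notMem (fun h => hA h.1)]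
  · intro W _ hW
    apply Set.indicator_of_notMem
    rintro ⟨_, hW'⟩
    exact hW hW'.symm
  · intro h; exact absurd (Finset.mem_univ _) h

/-! ## The `G`-avoidance is the gate of `H` at `N(z)` -/

omit [DecidableEq E] in
/-- **`s ↮_G T` iff `H` has the gate at `N(z)`** (for `s ≠ z`, `z ∉ T`). -/
theorem mem_avoidAll_iff_del_gateEvent {s : V} (hs : s ≠ z) {T : Finset V} (hT : z ∉ T)
    (ω : Config E) :
    ω ∈ avoidAll ends s T ↔
      delConfig ends {z} ω ∈ Gate.gateEvent ends s T (nbhd ends z ω) (nbhd ends z ω) := by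
  rw [Gate.mem_gateEvent]
  simp only [avoidAll, Set.mem_setOf_eq, Gate.hitsS, Gate.hitsK, mem_nbhd]
  constructor
  · intro h
    refine ⟨fun t ht hc => h t ht ((conn_iff_del hs (fun htz => hT (htz ▸ ht))).2 (Or.inl hc)), ?_⟩
    rintro ⟨⟨u, ⟨hzu, _⟩, hsu⟩, w, ⟨hzw, _⟩, t, ht, htw⟩
    exact h t ht ((conn_iff_del hs (fun htz => hT (htz ▸ ht))).2
      (Or.inr ⟨⟨u, hzu, hsu⟩, w, hzw, conn_symm htw⟩))
  · rintro ⟨hR, hno⟩ t ht hc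
    rcases (conn_iff_del hs (fun htz => hT (htz ▸ ht))).1 hc with hc | ⟨⟨u, hzu, hsu⟩, w, hzw, hwt⟩
    · exact hR t ht hc
    · have huz : u ≠ z := fun huz => hs (eq_of_conn_delConfig (huz ▸ hsu))
      have hwz : w ≠ z := fun hwz => hT ((eq_of_conn_delConfig (conn_symm (hwz ▸ hwt))) ▸ ht)
      exact hno ⟨⟨u, ⟨hzu, huz⟩, hsu⟩, w, ⟨hzw, hwz⟩, t, ht, conn_symm hwt⟩

end NewVertex

end Summit.Ventures.PercRepro2
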